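import Summits.CriticalPhenomena.PercolationContinuityZ3.Theorems.PercNearOneGluingAdditiveGluingWholeBlockReach
import Summits.CriticalPhenomena.PercolationContinuityZ3.Theorems.PercNearOneGluingAdditiveGluingWholeBlockDesignated
import HarnessLib

/-! # Crux `PercNearOneGluing.AdditiveGluing` (stmt-CriticalPhenomena-4576) — the T-form star expansion for a GLUED BLOCK observer
# (seat (b) V⁺-form, depth prover `png-dp-vplus`)

Support file (`--supports stmt-CriticalPhenomena-4576`); no definitions, no named facts.

`μ_{u/S} = prodBernoulli (u/S)` is bond percolation on `Fin n` with the block `S` glued (`(u/S) e = 1` on the non-loop pairs inside `S`,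
`= u e` otherwise); relays `A ∋ b` with `S ∩ A = ∅`, a designation `d ∉ S`.  The **T-functional of the block** is
`T_d^{u/S}(S) := μ_{u/S}(S ↮ A) + μ_{u/S}(S ↔ b) − μ_{u/S}(d ↔ b)`; the crux `AdditiveGluing` for an observer `o` is `T_{a*}^{u}({o}) ≥ 0`
(`a*` a minimiser of `μ_u(· ↔ b)` over `A`, `u/{o} = u`).  This file proves the exact expansion of the three terms over the LAYER `N` of `S`
(the outside vertices joined to `S` by an open pair; layer event `L_N = {ω | ∀ y, y ∈ N ↔ (y ∉ S ∧ ∃ o ∈ S, s(o, y) ∈ ω)}`):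

  `T_d^{u/S}(S) = Σ_N μ_{u/S}(L_N) · [ μ_{q_N}(N ↮ A) + μ_{q_N}(N ↔ b) − μ_{q_N}(d ↔ b) ]`      (`theorem T_blockExpansion`)

with `q_N` = `u` with every star of `S` killed and `N` glued — the bracket is the T-functional of the glued layer block `N` in the graph with
`S` deleted (for `N = ∅` it is `1 − μ_{q_∅}(d ↔ b)`).  Ingredients: the landed whole-block σ-identities R (`stub_wholeBlockReach_c5`, here
re-proved for a finite TARGET SET `X`, `wholeBlockReachSet`) and D (`stub_wholeBlockDesignated_c5`), and `Σ_N μ_{u/S}(L_N) = 1`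
(`sigmaRec_partition`).  This is the block version of seat (b)'s single-vertex `T_starExpansion` (…TStarExpansion.lean), in the
`q_N`-measure vocabulary of the lead's σ-calculus, so that the expansion can be ITERATED (the children are again glued blocks).
[cite: KozmaNitzan2024, §3.2 pp. 12–14 (the `σ_B`-decomposition, proofs of Thms 4–5)]
-/

namespace Summit.CriticalPhenomena.PercolationContinuityZ3.Theorems

open MeasureTheory Set
open Literature.Probability.LatticeModels (prodBernoulli)
open Literature.Probability.Percolation (BondConfig openConn openGraph)
open scoped BigOperators Classical

noncomputable section

section TBlockExpansion

variable {n : ℕ}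

/-- **Pointwise geometry of the whole-block layer, target set.**  If `N` is exactly the set of vertices outside `S` joined to `S` by an
open edge of `ω`, all non-loop pairs inside `S` are open, and `X` is disjoint from `S`, then `S` reaches `X` in `ω` iff `N` reaches `X` in
the glued off-block configuration `Ψ_N ω` (`stub_sigmaGeometry`, part 1, `O = S`). [cite: KozmaNitzan2024, §3.2 p. 14] -/
theorem wholeRS_geometry (S N X : Finset (Fin n)) (hX : Disjoint S X) (ω : BondConfig (Fin n))
    (hL : ∀ y : Fin n, y ∈ N ↔ (y ∉ S ∧ ∃ o ∈ S, s(o, y) ∈ ω))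
    (hK : ∀ o ∈ S, ∀ o' ∈ S, o ≠ o' → s(o, o') ∈ ω) :
    ω ∈ (⋃ v ∈ S, ⋃ x ∈ X, openConn v x : Set (BondConfig (Fin n))) ↔
      ({e | e ∈ ω ∧ ∀ y ∈ e, y ∉ S} ∪ {e | (∀ y ∈ e, y ∈ N) ∧ ¬ e.IsDiag} : BondConfig (Fin n)) ∈
        (⋃ v ∈ N, ⋃ x ∈ X, openConn v x : Set (BondConfig (Fin n))) :=
  (stub_sigmaGeometry n S N ω hL hK).1 X hX

/-- **One layer of identity R, target set.**  `μ_{u/S}(L_N ∩ {S ↔ X}) = μ_{u/S}(L_N ∩ Ψ_N⁻¹{N ↔ X})` for `X` disjoint from `S`: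
the clique event of the glued block is conull (`wholeD_clique_conull`) and on it the two events agree (`wholeRS_geometry`).
[cite: KozmaNitzan2024, §3.2 p. 14] -/
theorem wholeRS_layer_congr (u : Sym2 (Fin n) → unitInterval) (S N X : Finset (Fin n)) (hX : Disjoint S X) :
    (prodBernoulli (fun e : Sym2 (Fin n) => if (∀ y ∈ e, y ∈ S) ∧ ¬ e.IsDiag then 1 else u e)).real
        ({ω : BondConfig (Fin n) | ∀ y : Fin n, y ∈ N ↔ (y ∉ S ∧ ∃ o ∈ S, s(o, y) ∈ ω)} ∩
          ⋃ v ∈ S, ⋃ x ∈ X, openConn v x) =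
      (prodBernoulli (fun e : Sym2 (Fin n) => if (∀ y ∈ e, y ∈ S) ∧ ¬ e.IsDiag then 1 else u e)).real
        ({ω : BondConfig (Fin n) | ∀ y : Fin n, y ∈ N ↔ (y ∉ S ∧ ∃ o ∈ S, s(o, y) ∈ ω)} ∩
          {ω : BondConfig (Fin n) |
            ({e | e ∈ ω ∧ ∀ y ∈ e, y ∉ S} ∪ {e | (∀ y ∈ e, y ∈ N) ∧ ¬ e.IsDiag} : BondConfig (Fin n)) ∈
              (⋃ v ∈ N, ⋃ x ∈ X, openConn v x : Set (BondConfig (Fin n)))}) := by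
  refine sigmaRec_inter_congr _ (wholeD_clique_conull u S) fun ω hL hK => ?_
  exact wholeRS_geometry S N X hX ω hL hK

/-- **σ-identity R for a target set** (whole block): with the block `S` glued and `X` disjoint from `S`,
`μ_{u/S}(S ↔ X) = Σ_N μ_{u/S}(layer of S = N) · μ_{q_N}(N ↔ X)`, `q_N` = `u` with every star of `S` killed and `N` glued.
(`stub_wholeBlockReach_c5` is the case `X = {b}`.) [cite: KozmaNitzan2024, §3.2 pp. 13–14] -/
theorem wholeBlockReachSet (u : Sym2 (Fin n) → unitInterval) (S X : Finset (Fin n)) (hX : Disjoint S X) :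
    (prodBernoulli (fun e : Sym2 (Fin n) => if (∀ y ∈ e, y ∈ S) ∧ ¬ e.IsDiag then 1 else u e)).real
        (⋃ v ∈ S, ⋃ x ∈ X, openConn v x) =
      ∑ N : Finset (Fin n),
        (prodBernoulli (fun e : Sym2 (Fin n) => if (∀ y ∈ e, y ∈ S) ∧ ¬ e.IsDiag then 1 else u e)).real
            {ω : BondConfig (Fin n) | ∀ y : Fin n, y ∈ N ↔ (y ∉ S ∧ ∃ o ∈ S, s(o, y) ∈ ω)} *
          (prodBernoulli (fun e : Sym2 (Fin n) =>
              if (∀ y ∈ e, y ∈ N) ∧ ¬ e.IsDiag then 1 else if (∃ y ∈ e, y ∈ S) then 0 else u e)).real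
            (⋃ v ∈ N, ⋃ x ∈ X, openConn v x) := by
  rw [sigmaRec_partition (fun e : Sym2 (Fin n) => if (∀ y ∈ e, y ∈ S) ∧ ¬ e.IsDiag then 1 else u e) S
    (⋃ v ∈ S, ⋃ x ∈ X, openConn v x)]
  refine Finset.sum_congr rfl fun N _ => ?_
  rw [← stub_sigmaLaw n u S N (⋃ v ∈ N, ⋃ x ∈ X, openConn v x)]
  exact wholeRS_layer_congr u S N X hX

/-- **The layer law is a probability distribution**: `Σ_N μ_{u/S}(L_N) = 1`. [folklore] -/
theorem wholeBlock_layer_total (u : Sym2 (Fin n) → unitInterval) (S : Finset (Fin n)) :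
    ∑ N : Finset (Fin n),
        (prodBernoulli (fun e : Sym2 (Fin n) => if (∀ y ∈ e, y ∈ S) ∧ ¬ e.IsDiag then 1 else u e)).real
          {ω : BondConfig (Fin n) | ∀ y : Fin n, y ∈ N ↔ (y ∉ S ∧ ∃ o ∈ S, s(o, y) ∈ ω)} = 1 := by
  have h := sigmaRec_partition (fun e : Sym2 (Fin n) => if (∀ y ∈ e, y ∈ S) ∧ ¬ e.IsDiag then 1 else u e) S
    (Set.univ : Set (BondConfig (Fin n)))
  simp only [Set.inter_univ, probReal_univ] at h
  exact h.symm

/-- **Complement under the layer expansion**: for `X` disjoint from `S`,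
`μ_{u/S}((S ↔ X)ᶜ) = Σ_N μ_{u/S}(L_N) · μ_{q_N}((N ↔ X)ᶜ)`. [cite: KozmaNitzan2024, §3.2 pp. 13–14] -/
theorem wholeBlockReachSet_compl (u : Sym2 (Fin n) → unitInterval) (S X : Finset (Fin n)) (hX : Disjoint S X) :
    (prodBernoulli (fun e : Sym2 (Fin n) => if (∀ y ∈ e, y ∈ S) ∧ ¬ e.IsDiag then 1 else u e)).real
        (⋃ v ∈ S, ⋃ x ∈ X, openConn v x)ᶜ =
      ∑ N : Finset (Fin n),
        (prodBernoulli (fun e : Sym2 (Fin n) => if (∀ y ∈ e, y ∈ S) ∧ ¬ e.IsDiag then 1 else u e)).real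
            {ω : BondConfig (Fin n) | ∀ y : Fin n, y ∈ N ↔ (y ∉ S ∧ ∃ o ∈ S, s(o, y) ∈ ω)} *
          (prodBernoulli (fun e : Sym2 (Fin n) =>
              if (∀ y ∈ e, y ∈ N) ∧ ¬ e.IsDiag then 1 else if (∃ y ∈ e, y ∈ S) then 0 else u e)).real
            (⋃ v ∈ N, ⋃ x ∈ X, openConn v x)ᶜ := by
  have hc : ∀ (p : Sym2 (Fin n) → unitInterval) (E : Set (BondConfig (Fin n))),
      (prodBernoulli p).real Eᶜ = 1 - (prodBernoulli p).real E := by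
    intro p E
    rw [measureReal_compl (MeasurableSet.of_discrete), probReal_univ]
  rw [hc, wholeBlockReachSet u S X hX]
  conv_lhs => rw [← wholeBlock_layer_total u S]
  rw [← Finset.sum_sub_distrib]
  refine Finset.sum_congr rfl fun N _ => ?_
  rw [hc]
  ring

/-- **The T-form star expansion for a glued block** (exact, pocket-free).  `b ∈ A`, `Disjoint S A`, `d ∉ S`:
`μ_{u/S}(S ↮ A) + μ_{u/S}(S ↔ b) − μ_{u/S}(d ↔ b) = Σ_N μ_{u/S}(L_N) · [μ_{q_N}(N ↮ A) + μ_{q_N}(N ↔ b) − μ_{q_N}(d ↔ b)]`,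
`q_N` = `u` with every star of `S` killed and `N` glued; the bracket is the T-functional of the glued layer block `N` in the graph with `S`
deleted (`N = ∅`: `1 − μ_{q_∅}(d ↔ b)`).  Block version of seat (b)'s `T_starExpansion`. [cite: KozmaNitzan2024, §3.2 pp. 12–14] -/
theorem T_blockExpansion (u : Sym2 (Fin n) → unitInterval) (A S : Finset (Fin n)) (d b : Fin n)
    (hb : b ∈ A) (hSA : Disjoint S A) (hd : d ∉ S) :
    (prodBernoulli (fun e : Sym2 (Fin n) => if (∀ y ∈ e, y ∈ S) ∧ ¬ e.IsDiag then 1 else u e)).real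
          (⋃ v ∈ S, ⋃ a ∈ A, openConn v a)ᶜ +
        (prodBernoulli (fun e : Sym2 (Fin n) => if (∀ y ∈ e, y ∈ S) ∧ ¬ e.IsDiag then 1 else u e)).real
          (⋃ v ∈ S, openConn v b) -
        (prodBernoulli (fun e : Sym2 (Fin n) => if (∀ y ∈ e, y ∈ S) ∧ ¬ e.IsDiag then 1 else u e)).real
          (openConn d b) =
      ∑ N : Finset (Fin n),
        (prodBernoulli (fun e : Sym2 (Fin n) => if (∀ y ∈ e, y ∈ S) ∧ ¬ e.IsDiag then 1 else u e)).real
            {ω : BondConfig (Fin n) | ∀ y : Fin n, y ∈ N ↔ (y ∉ S ∧ ∃ o ∈ S, s(o, y) ∈ ω)} *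
          ((prodBernoulli (fun e : Sym2 (Fin n) =>
                if (∀ y ∈ e, y ∈ N) ∧ ¬ e.IsDiag then 1 else if (∃ y ∈ e, y ∈ S) then 0 else u e)).real
              (⋃ v ∈ N, ⋃ a ∈ A, openConn v a)ᶜ +
            (prodBernoulli (fun e : Sym2 (Fin n) =>
                if (∀ y ∈ e, y ∈ N) ∧ ¬ e.IsDiag then 1 else if (∃ y ∈ e, y ∈ S) then 0 else u e)).real
              (⋃ v ∈ N, openConn v b) -
            (prodBernoulli (fun e : Sym2 (Fin n) =>
                if (∀ y ∈ e, y ∈ N) ∧ ¬ e.IsDiag then 1 else if (∃ y ∈ e, y ∈ S) then 0 else u e)).real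
              (openConn d b)) := by
  have hbS : b ∉ S := fun h => Finset.disjoint_left.1 hSA h hb
  rw [wholeBlockReachSet_compl u S A hSA, stub_wholeBlockReach_c5 n u S b hbS,
    stub_wholeBlockDesignated_c5 n u S d b hd hbS, ← Finset.sum_add_distrib, ← Finset.sum_sub_distrib]
  refine Finset.sum_congr rfl fun N _ => ?_
  ring

/-- Registered rung `stub_TblockExpansion_vp` of crux stmt-CriticalPhenomena-4576 (depth prover png-dp-vplus, seat (b) V⁺-form): the T-form
star expansion for a glued block observer — `T_blockExpansion`, closed statement. [cite: KozmaNitzan2024, §3.2 pp. 12–14] -/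
theorem stub_TblockExpansion_vp : ∀ (n : ℕ) (u : Sym2 (Fin n) → unitInterval) (A S : Finset (Fin n)) (d b : Fin n), b ∈ A → Disjoint S A → d ∉ S → (Literature.Probability.LatticeModels.prodBernoulli (fun e : Sym2 (Fin n) => if (∀ y ∈ e, y ∈ S) ∧ ¬ e.IsDiag then 1 else u e)).real (⋃ v ∈ S, ⋃ a ∈ A, Literature.Probability.Percolation.openConn v a)ᶜ + (Literature.Probability.LatticeModels.prodBernoulli (fun e : Sym2 (Fin n) => if (∀ y ∈ e, y ∈ S) ∧ ¬ e.IsDiag then 1 else u e)).real (⋃ v ∈ S, Literature.Probability.Percolation.openConn v b) - (Literature.Probability.LatticeModels.prodBernoulli (fun e : Sym2 (Fin n) => if (∀ y ∈ e, y ∈ S) ∧ ¬ e.IsDiag then 1 else u e)).real (Literature.Probability.Percolation.openConn d b) = ∑ N : Finset (Fin n), (Literature.Probability.LatticeModels.prodBernoulli (fun e : Sym2 (Fin n) => if (∀ y ∈ e, y ∈ S) ∧ ¬ e.IsDiag then 1 else u e)).real {ω : Literature.Probability.Percolation.BondConfig (Fin n) | ∀ y : Fin n, y ∈ N ↔ (y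 ∉ S ∧ ∃ o ∈ S, s(o, y) ∈ ω)} * ((Literature.Probability.LatticeModels.prodBernoulli (fun e : Sym2 (Fin n) => if (∀ y ∈ e, y ∈ N) ∧ ¬ e.IsDiag then 1 else if (∃ y ∈ e, y ∈ S) then 0 else u e)).real (⋃ v ∈ N, ⋃ a ∈ A, Literature.Probability.Percolation.openConn v a)ᶜ + (Literature.Probability.LatticeModels.prodBernoulli (fun e : Sym2 (Fin n) => if (∀ y ∈ e, y ∈ N) ∧ ¬ e.IsDiag then 1 else if (∃ y ∈ e, y ∈ S) then 0 else u e)).real (⋃ v ∈ N, Literature.Probability.Percolation.openConn v b) - (Literature.Probability.LatticeModels.prodBernoulli (fun e : Sym2 (Fin n) => if (∀ y ∈ e, y ∈ N) ∧ ¬ e.IsDiag then 1 else if (∃ y ∈ e, y ∈ S) then 0 else u e)).real (Literature.Probability.Percolation.openConn d b)) :=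
  fun _ u A S d b hb hSA hd => T_blockExpansion u A S d b hb hSA hd

end TBlockExpansion

end

end Summit.CriticalPhenomena.PercolationContinuityZ3.Theorems
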